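import Literature.Analysis.FluidPDE.ElgindiSineModes
import Mathlib.Analysis.Real.Pi.Bounds
import Mathlib.Analysis.SpecialFunctions.Integrals.Basic
import HarnessLib

/-!
# The constrained Poincaré inequality of the mode `sin θ cos² θ` ([Elgindi2021] §7.1,
Proposition 7.1 Step 2)

Topic `Literature/Analysis/FluidPDE`. Proof file (everything proved, no definitions, no named
facts) on the proof path of the named fact
`Literature.Analysis.FluidPDE.Elgindi.ElgindiGhoulMasmoudi2021_stabilityCore`
(`ElgindiStabilityDecomposition.lean`). T. M. Elgindi, Ann. of Math. 194 (2021) =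
arXiv:1904.04795, §7.1 proof of Proposition 7.1, Step 2 (p. 19):

> "`|∂_θΨ|² − 6|Ψ|² ≤ |F|_{L²}|Ψ|_{L²}` … `Σ_{n≥2}(4n² − 6)|Ψ_n(R)|² ≤ 2|Ψ_1(R)|² + |F||Ψ|`. But we also
> know that `Ψ_⋆ ≡ 0`. Thus, `0 = (4/π)Σ_nΨ_n(R)∫₀^{π/2}sinθcos²θ sin(2nθ)dθ` … In particular
> `|Ψ_1| ≤ Σ_{n≥2}|Ψ_n|·(…)`. Thus, `|Ψ_1|² ≤ 81Σ_{n≥2}|Ψ_n|²Σ_{n≥2}(…) < Σ_{n≥2}|Ψ_n|²` … Thus,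
> `Σ_{n≥1}4n²|Ψ_n(R)|² ≤ 4|F||Ψ|`."

The mathematical content of this step is a one-dimensional **constrained Poincaré inequality**:
orthogonality to `sin θ cos² θ` pushes the Dirichlet Rayleigh quotient of `−∂_θθ` on `[0, π/2]` above
the dangerous constant `6`. This file proves `12∫₀^{π/2}φ² ≤ ∫₀^{π/2}φ'²` for `φ ∈ C¹(ℝ)` with
`φ(0) = φ(π/2) = 0` and `∫₀^{π/2}φ sinθcos²θ = 0` (`orthogonalMode_poincare`), by the printed route:
polarized Parseval for the sine coefficients (`hasSum_sineCoeff_mul`) turns the orthogonality into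
`Σ_n b_n(φ)I_n = 0`, `I_n = ∫₀^{π/2}sinθcos²θ sin(2nθ)dθ`; Cauchy–Schwarz over the modes `|n| ≥ 2`
with `Σ_{|n|≥2}I_n² = (π/2)∫sin²cos⁴ − 2I_1² = π²/64 − 32/225 ≤ I_1² = 16/225` bounds the first mode
`4b_1² ≤ Σ_{|n|≥2}b_n²`, and Parseval for `φ'` concludes. (The printed closed form
`I_n = (−1)ⁿ4n/((2n−3)²(2n+1)²)` is a misprint for `(−1)ⁿ4n/((4n²−9)(4n²−1))`, e.g. `I_1 = 4/15`; only
`I_1` and `ΣI_n²` are used here.)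
-/

noncomputable section

open MeasureTheory Set Real Filter intervalIntegral
open _root_.Topology

namespace Literature.Analysis.FluidPDE

namespace Elgindi

/-! ### The two numbers -/

/-- `I₁ = ∫₀^{π/2} sinθcos²θ·sin2θ dθ = 4/15`. [cite: Elgindi2021, §7.1 proof of Proposition 7.1 Step 2 (p. 19 of arXiv:1904.04795)] -/
theorem integral_orthMode_mul_sin_two :
    ∫ x in (0 : ℝ)..(π / 2), Real.sin x * Real.cos x ^ 2 * Real.sin (2 * x) = 4 / 15 := by
  have hder : ∀ x ∈ Set.uIcc (0 : ℝ) (π / 2),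
      HasDerivAt (fun x => 2 * (Real.sin x ^ 3 / 3 - Real.sin x ^ 5 / 5))
        (Real.sin x * Real.cos x ^ 2 * Real.sin (2 * x)) x := by
    intro x _
    have hs := Real.hasDerivAt_sin x
    have h3 : HasDerivAt (fun x => Real.sin x ^ 3 / 3) (Real.sin x ^ 2 * Real.cos x) x := by
      have := (hs.pow 3).div_const 3
      exact this.congr_deriv (by ring)
    have h5 : HasDerivAt (fun x => Real.sin x ^ 5 / 5) (Real.sin x ^ 4 * Real.cos x) x := by
      have := (hs.pow 5).div_const 5
      exact this.congr_deriv (by ring)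
    have h := (h3.sub h5).const_mul 2
    refine h.congr_deriv ?_
    rw [Real.sin_two_mul]
    have := Real.sin_sq_add_cos_sq x
    linear_combination (-(2 * Real.sin x ^ 2 * Real.cos x)) * this
  rw [integral_eq_sub_of_hasDerivAt hder ((by fun_prop : Continuous fun x =>
    Real.sin x * Real.cos x ^ 2 * Real.sin (2 * x)).intervalIntegrable _ _)]
  simp
  norm_num

/-- `∫₀^{π/2} sin²θcos⁴θ dθ = π/32`. [folklore] -/
theorem integral_sq_orthMode :
    ∫ x in (0 : ℝ)..(π / 2), (Real.sin x * Real.cos x ^ 2) * (Real.sin x * Real.cos x ^ 2) = π / 32 := by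
  -- `sin²cos⁴ = sin²(2θ)/8 + sin²(2θ)cos(2θ)/8`
  have e : ∀ x : ℝ, (Real.sin x * Real.cos x ^ 2) * (Real.sin x * Real.cos x ^ 2) =
      (1 / 8) * Real.sin (2 * x) ^ 2 + (1 / 8) * (Real.sin (2 * x) ^ 2 * Real.cos (2 * x)) := by
    intro x
    rw [Real.sin_two_mul, Real.cos_two_mul]
    ring
  simp_rw [e]
  have i1 : IntervalIntegrable (fun x => (1 / 8) * Real.sin (2 * x) ^ 2) volume 0 (π / 2) :=
    (by fun_prop : Continuous fun x => (1 / 8) * Real.sin (2 * x) ^ 2).intervalIntegrable _ _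
  have i2 : IntervalIntegrable (fun x => (1 / 8) * (Real.sin (2 * x) ^ 2 * Real.cos (2 * x))) volume 0 (π / 2) :=
    (by fun_prop : Continuous fun x => (1 / 8) * (Real.sin (2 * x) ^ 2 * Real.cos (2 * x))).intervalIntegrable _ _
  rw [intervalIntegral.integral_add i1 i2, intervalIntegral.integral_const_mul, intervalIntegral.integral_const_mul]
  -- `∫₀^{π/2} sin²(2x) = π/4`
  have h1 : ∫ x in (0 : ℝ)..(π / 2), Real.sin (2 * x) ^ 2 = π / 4 := by
    have := intervalIntegral.integral_comp_mul_left (fun x => Real.sin x ^ 2) (a := 0) (b := π / 2) two_ne_zero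
    rw [this]
    simp only [mul_zero, smul_eq_mul]
    rw [show (2 : ℝ) * (π / 2) = π by ring, integral_sin_sq]
    simp
    ring
  -- `∫₀^{π/2} sin²(2x)cos(2x) = 0`
  have h2 : ∫ x in (0 : ℝ)..(π / 2), Real.sin (2 * x) ^ 2 * Real.cos (2 * x) = 0 := by
    have hder : ∀ x ∈ Set.uIcc (0 : ℝ) (π / 2),
        HasDerivAt (fun x => Real.sin (2 * x) ^ 3 / 6) (Real.sin (2 * x) ^ 2 * Real.cos (2 * x)) x := by
      intro x _
      have hlin : HasDerivAt (fun y : ℝ => 2 * y) 2 x := by simpa using (hasDerivAt_id' x).const_mul 2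
      have := (hlin.sin.pow 3).div_const 6
      exact this.congr_deriv (by ring)
    rw [integral_eq_sub_of_hasDerivAt hder ((by fun_prop : Continuous fun x =>
      Real.sin (2 * x) ^ 2 * Real.cos (2 * x)).intervalIntegrable _ _)]
    rw [show (2 : ℝ) * (π / 2) = π by ring]
    simp
  rw [h1, h2]
  ring

/-! ### Cauchy–Schwarz through the `t`-trick -/

/-- If `|R| ≤ (tY + J/t)/2` for all `t > 0` (`Y, J ≥ 0`), then `R² ≤ YJ`. [folklore] -/
theorem sq_le_mul_of_forall_pos {R Y J : ℝ} (hY : 0 ≤ Y) (hJ : 0 ≤ J)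
    (h : ∀ t : ℝ, 0 < t → |R| ≤ (t * Y + J / t) / 2) : R ^ 2 ≤ Y * J := by
  rcases eq_or_lt_of_le hY with hY0 | hYpos
  · -- `Y = 0`: `|R| ≤ J/(2t) → 0`
    subst hY0
    have hR : R = 0 := by
      by_contra hne
      have hRpos : 0 < |R| := abs_pos.2 hne
      have := h ((J + 1) / |R|) (by positivity)
      rw [mul_zero, zero_add] at this
      have e : J / ((J + 1) / |R|) / 2 = |R| * (J / (J + 1)) / 2 := by field_simp
      rw [e] at this
      have hlt : J / (J + 1) < 1 := by rw [div_lt_one (by positivity)]; linarith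
      nlinarith
    simp [hR]
  rcases eq_or_lt_of_le hJ with hJ0 | hJpos
  · subst hJ0
    have hR : R = 0 := by
      by_contra hne
      have hRpos : 0 < |R| := abs_pos.2 hne
      have := h (|R| / Y) (by positivity)
      rw [zero_div, add_zero] at this
      have e : |R| / Y * Y / 2 = |R| / 2 := by field_simp
      rw [e] at this
      linarith
    simp [hR]
  · set t := Real.sqrt (J / Y) with ht
    have htpos : 0 < t := Real.sqrt_pos.2 (by positivity)
    have ht2 : t ^ 2 = J / Y := Real.sq_sqrt (by positivity)
    have h1 := h t htpos
    have e : (t * Y + J / t) / 2 = t * Y := by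
      have : J = t ^ 2 * Y := by rw [ht2]; field_simp
      rw [this]; field_simp; ring
    rw [e] at h1
    calc R ^ 2 = |R| ^ 2 := (sq_abs R).symm
      _ ≤ (t * Y) ^ 2 := pow_le_pow_left₀ (abs_nonneg _) h1 2
      _ = Y * J := by rw [mul_pow, ht2]; field_simp

/-! ### The sine coefficients: symmetries -/

/-- `b_{−n} = −b_n`. [folklore] -/
theorem sineMoment_neg (h : ℝ → ℝ) (n : ℤ) :
    ∫ x in (0 : ℝ)..(π / 2), h x * Real.sin (2 * ((-n : ℤ) : ℝ) * x) =
      -∫ x in (0 : ℝ)..(π / 2), h x * Real.sin (2 * (n : ℝ) * x) := by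
  rw [← intervalIntegral.integral_neg]
  refine intervalIntegral.integral_congr fun x _ => ?_
  simp only [Int.cast_neg]
  rw [show 2 * -(n : ℝ) * x = -(2 * n * x) by ring, Real.sin_neg]; ring

/-- `b_0 = 0`. [folklore] -/
theorem sineMoment_zero (h : ℝ → ℝ) : ∫ x in (0 : ℝ)..(π / 2), h x * Real.sin (2 * ((0 : ℤ) : ℝ) * x) = 0 := by
  simp

/-! ### The constrained Poincaré inequality -/

/-- **Orthogonality to `sinθcos²θ` raises the Dirichlet gap above `6`**: for `φ ∈ C¹(ℝ)` with
`φ(0) = φ(π/2) = 0` and `∫₀^{π/2}φ(θ)sinθcos²θ dθ = 0`, `12∫₀^{π/2}φ² ≤ ∫₀^{π/2}φ'²`. [cite: Elgindi2021, §7.1 proof of Proposition 7.1, Step 2 (p. 19 of arXiv:1904.04795)] -/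
theorem orthogonalMode_poincare {φ : ℝ → ℝ} (hφ : ContDiff ℝ 1 φ) (h0 : φ 0 = 0) (h1 : φ (π / 2) = 0)
    (horth : ∫ x in (0 : ℝ)..(π / 2), φ x * (Real.sin x * Real.cos x ^ 2) = 0) :
    12 * ∫ x in (0 : ℝ)..(π / 2), φ x ^ 2 ≤ ∫ x in (0 : ℝ)..(π / 2), deriv φ x ^ 2 := by
  have hφc : Continuous φ := hφ.continuous
  have hψ : Continuous (oddExt φ) := continuous_oddExt hφ h0
  set g : ℝ → ℝ := fun x => Real.sin x * Real.cos x ^ 2 with hg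
  have hgc : Continuous g := by simp only [hg]; fun_prop
  have hg0 : g 0 = 0 := by simp [hg]
  set b : ℤ → ℝ := fun n => ∫ x in (0 : ℝ)..(π / 2), φ x * Real.sin (2 * n * x) with hb
  set I : ℤ → ℝ := fun n => ∫ x in (0 : ℝ)..(π / 2), g x * Real.sin (2 * n * x) with hI
  -- Parseval facts
  have F1 : HasSum (fun n => b n * I n) 0 := by
    have := hasSum_sineCoeff_mul hφc hgc h0 hg0
    rw [horth, mul_zero] at this
    exact this
  have F2 : HasSum (fun n => b n ^ 2) (π / 2 * ∫ x in (0 : ℝ)..(π / 2), φ x ^ 2) := by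
    have := hasSum_sineCoeff_mul hφc hφc h0 h0
    have e : (∫ x in (0 : ℝ)..(π / 2), φ x * φ x) = ∫ x in (0 : ℝ)..(π / 2), φ x ^ 2 :=
      intervalIntegral.integral_congr fun x _ => by ring
    rw [e] at this
    simpa [sq] using this
  have F3 : HasSum (fun n => I n ^ 2) (π ^ 2 / 64) := by
    have := hasSum_sineCoeff_mul hgc hgc hg0 hg0
    rw [integral_sq_orthMode] at this
    have e : π / 2 * (π / 32) = π ^ 2 / 64 := by ring
    rw [e] at this
    simpa [sq] using this
  have F4 : HasSum (fun n : ℤ => 4 * (n : ℝ) ^ 2 * b n ^ 2) (π / 2 * ∫ x in (0 : ℝ)..(π / 2), deriv φ x ^ 2) := by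
    have h := (hasSum_sq_sineCoeff_deriv hφ h0 h1).mul_left (π ^ 2 / 4)
    have eterm : (fun n : ℤ => π ^ 2 / 4 * (4 * (n : ℝ) ^ 2 *
        ‖fourierCoeffOn neg_half_pi_lt_half_pi (fun x => (oddExt φ x : ℂ)) n‖ ^ 2)) =
        fun n : ℤ => 4 * (n : ℝ) ^ 2 * b n ^ 2 := by
      funext n
      simp only [hb]
      rw [norm_sq_sineCoeff h0 hψ n]
      field_simp
      try ring
    have etot : π ^ 2 / 4 * (2 / π * ∫ x in (0 : ℝ)..(π / 2), deriv φ x ^ 2) =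
        π / 2 * ∫ x in (0 : ℝ)..(π / 2), deriv φ x ^ 2 := by
      field_simp
      ring
    rw [eterm, etot] at h
    exact h
  -- values at `0, ±1`
  have hb0 : b 0 = 0 := by simp [hb]
  have hI0 : I 0 = 0 := by simp [hI]
  have hbm : b (-1) = -b 1 := by
    have := sineMoment_neg φ 1
    simpa only [hb, neg_neg] using this
  have hIm : I (-1) = -I 1 := by
    have := sineMoment_neg g 1
    simpa only [hI, neg_neg] using this
  have hI1 : I 1 = 4 / 15 := by
    have e : I 1 = ∫ x in (0 : ℝ)..(π / 2), Real.sin x * Real.cos x ^ 2 * Real.sin (2 * x) := by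
      simp only [hI, hg]
      refine intervalIntegral.integral_congr fun x _ => ?_
      simp
    rw [e, integral_orthMode_mul_sin_two]
  -- restriction to the modes `|n| ≥ 2`
  set s : Finset ℤ := {0, 1, -1} with hs
  have hmem : ∀ n : ℤ, n ∈ s ↔ n = 0 ∨ n = 1 ∨ n = -1 := fun n => by simp [hs]
  have rest : ∀ (f : ℤ → ℝ) (S : ℝ), HasSum f S →
      HasSum (fun n => if n = 0 ∨ n = 1 ∨ n = -1 then 0 else f n) (S - (f 0 + f 1 + f (-1))) := by
    intro f S hf
    have hfin : HasSum (fun n => if n = 0 ∨ n = 1 ∨ n = -1 then f n else 0) (f 0 + f 1 + f (-1)) := by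
      have h : HasSum (fun n => if n = 0 ∨ n = 1 ∨ n = -1 then f n else 0)
          (∑ n ∈ s, (if n = 0 ∨ n = 1 ∨ n = -1 then f n else 0)) :=
        hasSum_sum_of_ne_finset_zero (fun n hn => by rw [hmem] at hn; simp [hn])
      have e : ∑ n ∈ s, (if n = 0 ∨ n = 1 ∨ n = -1 then f n else 0) = f 0 + f 1 + f (-1) := by
        rw [hs, Finset.sum_insert (by simp), Finset.sum_insert (by simp), Finset.sum_singleton]
        simp
        ring
      rw [e] at h
      exact h
    have h := hf.sub hfin
    have e : (fun n => f n - if n = 0 ∨ n = 1 ∨ n = -1 then f n else 0) =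
        fun n => if n = 0 ∨ n = 1 ∨ n = -1 then 0 else f n := by
      funext n; split_ifs <;> ring
    rw [e] at h
    exact h
  have R1 := rest _ _ F1
  have R2 := rest _ _ F2
  have R3 := rest _ _ F3
  rw [hb0, hI0, hbm, hIm] at R1
  rw [hb0, hbm] at R2
  rw [hI0, hIm, hI1] at R3
  set Y : ℝ := π / 2 * (∫ x in (0 : ℝ)..(π / 2), φ x ^ 2) - (0 ^ 2 + b 1 ^ 2 + (-b 1) ^ 2) with hY
  set J : ℝ := π ^ 2 / 64 - (0 ^ 2 + (4 / 15) ^ 2 + (-(4 / 15)) ^ 2) with hJ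
  have hY0 : 0 ≤ Y := R2.nonneg fun n => by positivity
  have hJ0 : 0 ≤ J := R3.nonneg fun n => by positivity
  -- Cauchy–Schwarz: `(2 b₁ I₁)² ≤ Y J`
  have hCS : (0 - (0 * 0 + b 1 * I 1 + -b 1 * -I 1)) ^ 2 ≤ Y * J := by
    refine sq_le_mul_of_forall_pos hY0 hJ0 fun t ht => ?_
    rw [abs_le]
    constructor
    · -- lower bound: `−(rest b I) ≤ (tY + J/t)/2`
      have hcmp : ∀ n : ℤ, -(if n = 0 ∨ n = 1 ∨ n = -1 then 0 else b n * I n) ≤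
          (t * (if n = 0 ∨ n = 1 ∨ n = -1 then 0 else b n ^ 2) + (if n = 0 ∨ n = 1 ∨ n = -1 then 0 else I n ^ 2) / t) / 2 := by
        intro n
        split_ifs
        · simp
        · have e : (t * b n ^ 2 + I n ^ 2 / t) / 2 + b n * I n = (t * b n + I n) ^ 2 / (2 * t) := by
            field_simp
            ring
          have key : 0 ≤ (t * b n ^ 2 + I n ^ 2 / t) / 2 + b n * I n := by rw [e]; positivity
          linarith
      have := hasSum_le hcmp R1.neg (((R2.mul_left t).add (R3.div_const t)).div_const 2)
      linarith
    · have hcmp : ∀ n : ℤ, (if n = 0 ∨ n = 1 ∨ n = -1 then 0 else b n * I n) ≤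
          (t * (if n = 0 ∨ n = 1 ∨ n = -1 then 0 else b n ^ 2) + (if n = 0 ∨ n = 1 ∨ n = -1 then 0 else I n ^ 2) / t) / 2 := by
        intro n
        split_ifs
        · simp
        · have e : (t * b n ^ 2 + I n ^ 2 / t) / 2 - b n * I n = (t * b n - I n) ^ 2 / (2 * t) := by
            field_simp
            ring
          have key : 0 ≤ (t * b n ^ 2 + I n ^ 2 / t) / 2 - b n * I n := by rw [e]; positivity
          linarith
      have := hasSum_le hcmp R1 (((R2.mul_left t).add (R3.div_const t)).div_const 2)
      linarith
  -- `J ≤ I₁²`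
  have hJle : J ≤ (4 / 15) ^ 2 := by
    rw [hJ]
    nlinarith [Real.pi_lt_d2, Real.pi_pos]
  -- hence `4 b₁² ≤ Y`
  have h4 : 4 * b 1 ^ 2 ≤ Y := by
    have e : (0 - (0 * 0 + b 1 * I 1 + -b 1 * -I 1)) ^ 2 = 4 * b 1 ^ 2 * (4 / 15) ^ 2 := by rw [hI1]; ring
    rw [e] at hCS
    have := hCS.trans (mul_le_mul_of_nonneg_left hJle hY0)
    nlinarith
  -- Parseval for `φ'` against `16Σb² − (first modes)`
  set e : ℤ → ℝ := fun n => if n = 0 then 16 * b n ^ 2 else if n = 1 ∨ n = -1 then 12 * b n ^ 2 else 0 with he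
  have hE : HasSum e (16 * b 0 ^ 2 + 12 * b 1 ^ 2 + 12 * b (-1) ^ 2) := by
    have h : HasSum e (∑ n ∈ s, e n) := hasSum_sum_of_ne_finset_zero (fun n hn => by
      rw [hmem] at hn; simp only [not_or] at hn; simp [he, hn.1, hn.2.1, hn.2.2])
    have e1 : ∑ n ∈ s, e n = 16 * b 0 ^ 2 + 12 * b 1 ^ 2 + 12 * b (-1) ^ 2 := by
      rw [hs, Finset.sum_insert (by simp), Finset.sum_insert (by simp), Finset.sum_singleton]
      simp [he]
      ring
    rw [e1] at h
    exact h
  have hcmp : ∀ n : ℤ, 16 * b n ^ 2 - e n ≤ 4 * (n : ℝ) ^ 2 * b n ^ 2 := by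
    intro n
    simp only [he]
    split_ifs with hn0 hn1
    · subst hn0; simp
    · have hsq : (n : ℝ) ^ 2 = 1 := by rcases hn1 with rfl | rfl <;> norm_num
      rw [hsq]
      linarith [sq_nonneg (b n)]
    · have hn2 : (2 : ℝ) ≤ |(n : ℝ)| := by
        rw [← Int.cast_abs]
        have : (2 : ℤ) ≤ |n| := by
          obtain ⟨h1', h2'⟩ := not_or.1 hn1
          rcases le_or_gt 0 n with h | h
          · rw [abs_of_nonneg h]; omega
          · rw [abs_of_neg h]; omega
        exact_mod_cast this
      have h4' : (4 : ℝ) ≤ (n : ℝ) ^ 2 := by rw [← sq_abs]; nlinarith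
      have hb2 := sq_nonneg (b n)
      have : 12 * b n ^ 2 ≤ (4 * (n : ℝ) ^ 2 - 4) * b n ^ 2 := by
        have : (12 : ℝ) ≤ 4 * (n : ℝ) ^ 2 - 4 := by linarith
        exact mul_le_mul_of_nonneg_right this hb2
      linarith
  have hle := hasSum_le hcmp ((F2.mul_left 16).sub hE) F4
  rw [hb0, hbm] at hle
  rw [hY] at h4
  have hπ := Real.pi_pos
  have hfin : 0 ≤ π / 2 * (∫ x in (0 : ℝ)..(π / 2), deriv φ x ^ 2) - 12 * (π / 2 * ∫ x in (0 : ℝ)..(π / 2), φ x ^ 2) := by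
    linarith [h4, hle]
  by_contra hlt
  have hlt' := not_le.1 hlt
  have := mul_lt_mul_of_pos_left hlt' (half_pos hπ)
  linarith

end Elgindi

end Literature.Analysis.FluidPDE
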